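import Summits.RiemannHypothesis.RiemannHypothesis.Theorems.SoloInformedMeanValue
import Literature.NumberTheory.LFunctions.WeilFinitePrimeQuadratic
import Literature.NumberTheory.LFunctions.WeilMarkovQuadratic
import Literature.NumberTheory.LFunctions.WeilLineSupSamplingPrelim
import HarnessLib

/-!
# T72f — the prime side of a modulated autocorrelation and its mean square (solo-informed, R2b)

Sixth file of the local pair-correlation rigidity line (sharpest statement §2k (xi), plan T72).
For a Weil test `g` and the modulated test `g_t(x) = g(x) e^{-itx}`:

* `weilConv_weilReflect_modulate` — modulation commutes with autocorrelation:
  `(g_t ⋆ g̃_t)(u) = e^{-itu} (g ⋆ g̃)(u)`;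
* `re_weilPrimeTerm_modulate` — if `supp g ⊆ [-B, B]` and `2B ≤ log (N+1)`, the prime side of
  the explicit formula for `g_t ⋆ g̃_t` is (the real part of) a Dirichlet polynomial of length
  `N` evaluated at `t`:  `P(g_t ⋆ g̃_t) = 2 Re Σ_{n ≤ N} Λ(n) n^{-1/2} φ(log n) n^{-it}`,
  `φ = g ⋆ g̃`;
* `sq_re_weilPrimeTerm_modulate_le` — hence `P(g_t ⋆ g̃_t)² ≤ 4 |D(t)|²`;
* `intervalIntegral_sq_re_weilPrimeTerm_modulate_le` — **window mean square**: by T72a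
  (`norm_sq_dirichletSum_intervalIntegral_le`) and `|φ| ≤ ‖g‖₂²`,
  `∫_{T₁}^{T₂} P(g_t ⋆ g̃_t)² dt ≤ 4 (T₂ − T₁ + 2N²) ‖g‖₂⁴ Σ_{n ≤ N} Λ(n)²/n`.

With `g = Φ_b` (support radius `B = b/2`, `N = ⌊e^b⌋`) and T72e this is the bound
`E_W[P²] = O(b²) = O(log² h)` on windows of length `≥ e^{2b}` used in Lemma 2k.E.

References: H. L. Montgomery, R. C. Vaughan, *Hilbert's inequality*, J. London Math. Soc. (2) 8
(1974) 73–82; E. Bombieri, *Remarks on Weil's quadratic functional in the theory of prime numbers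
I*, Rend. Mat. Acc. Lincei (9) 11 (2000), Thm 2 (prime side; key `Bombieri2000Weil`).
-/

noncomputable section

open Complex Filter Set Topology MeasureTheory
open Literature.NumberTheory.LFunctions
open scoped Real

namespace Summit.RiemannHypothesis.RiemannHypothesis.Theorems

/-- Modulation commutes with autocorrelation: `(g_c ⋆ g̃_c)(u) = e^{icu} (g ⋆ g̃)(u)` for
`g_c(x) = g(x) e^{icx}`. -/
theorem weilConv_weilReflect_modulate (g : ℝ → ℂ) (c u : ℝ) :
    weilConv (fun x ↦ g x * cexp ((c * x : ℝ) * I))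
        (weilReflect fun x ↦ g x * cexp ((c * x : ℝ) * I)) u =
      cexp ((c * u : ℝ) * I) * weilConv g (weilReflect g) u := by
  rw [weilConv_apply, weilConv_apply, ← integral_const_mul]
  congr 1 with y
  simp only [weilReflect, map_mul, ← Complex.exp_conj, Complex.conj_ofReal, Complex.conj_I]
  have h : cexp (((c * y : ℝ) : ℂ) * I) * cexp (((c * -(u - y) : ℝ) : ℂ) * -I) =
      cexp (((c * u : ℝ) : ℂ) * I) := by
    rw [← Complex.exp_add]
    congr 1
    push_cast
    ring
  calc g y * cexp (((c * y : ℝ) : ℂ) * I) *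
        ((starRingEnd ℂ) (g (-(u - y))) * cexp (((c * -(u - y) : ℝ) : ℂ) * -I))
      = cexp (((c * y : ℝ) : ℂ) * I) * cexp (((c * -(u - y) : ℝ) : ℂ) * -I) *
          (g y * (starRingEnd ℂ) (g (-(u - y)))) := by ring
    _ = cexp (((c * u : ℝ) : ℂ) * I) * (g y * (starRingEnd ℂ) (g (-(u - y)))) := by rw [h]

/-- Support of a modulated autocorrelation: `supp g ⊆ [-B, B]` gives
`supp (g_c ⋆ g̃_c) ⊆ [-2B, 2B]`. -/
theorem tsupport_weilConv_weilReflect_modulate_subset {g : ℝ → ℂ} (hg : IsWeilTest g) {B : ℝ}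
    (hB : tsupport g ⊆ Icc (-B) B) (c : ℝ) :
    tsupport (weilConv (fun x ↦ g x * cexp ((c * x : ℝ) * I))
        (weilReflect fun x ↦ g x * cexp ((c * x : ℝ) * I))) ⊆ Icc (-(2 * B)) (2 * B) :=
  tsupport_weilConv_weilReflect_subset (isWeilTest_mul_cexp_ofReal_mul_I hg c).2
    ((tsupport_mul_cexp_subset g c).trans hB)

/-- **The prime side of `g_t ⋆ g̃_t` is a Dirichlet polynomial at `t`.** If `supp g ⊆ [-B, B]`
and `2B ≤ log (N+1)` then
`P(g_t ⋆ g̃_t) = 2 Re Σ_{n=1}^{N} Λ(n) n^{-1/2} φ(log n) e^{-it log n}` with `φ = g ⋆ g̃`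
(`g_t(x) = g(x) e^{-itx}`; the prime side is real). -/
theorem re_weilPrimeTerm_modulate {g : ℝ → ℂ} (hg : IsWeilTest g) {B : ℝ}
    (hB : tsupport g ⊆ Icc (-B) B) {N : ℕ} (hN : 2 * B ≤ Real.log ((N : ℝ) + 1)) (t : ℝ) :
    (weilPrimeTerm (weilConv (fun x ↦ g x * cexp (((-t) * x : ℝ) * I))
        (weilReflect fun x ↦ g x * cexp (((-t) * x : ℝ) * I)))).re =
      2 * (∑ n ∈ Finset.Icc 1 N, ((ArithmeticFunction.vonMangoldt n : ℝ) : ℂ) /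
          (Real.sqrt n : ℂ) * weilConv g (weilReflect g) (Real.log n) *
          cexp (((-(Real.log n * t) : ℝ) : ℂ) * I)).re := by
  have hf := isWeilTest_mul_cexp_ofReal_mul_I hg (-t)
  have hk := hf.weilConv hf.weilReflect
  have hks : tsupport (weilConv (fun x ↦ g x * cexp (((-t) * x : ℝ) * I))
      (weilReflect fun x ↦ g x * cexp (((-t) * x : ℝ) * I))) ⊆
      Icc (-Real.log ((N : ℝ) + 1)) (Real.log ((N : ℝ) + 1)) :=
    (tsupport_weilConv_weilReflect_modulate_subset hg hB (-t)).trans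
      (Icc_subset_Icc (by linarith) hN)
  rw [weilPrimeTerm_eq_sum_of_tsupport_subset hk.1.continuous N hks]
  have hsub : Finset.Icc 1 N ⊆ Finset.range (N + 1) := fun n hn ↦ by
    rw [Finset.mem_Icc] at hn
    rw [Finset.mem_range]
    omega
  have hzero : ∀ n ∈ Finset.range (N + 1), n ∉ Finset.Icc 1 N →
      ((ArithmeticFunction.vonMangoldt n : ℝ) : ℂ) / (Real.sqrt n : ℂ) *
          weilConv g (weilReflect g) (Real.log n) *
          cexp (((-(Real.log n * t) : ℝ) : ℂ) * I) = 0 := by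
    intro n hn hn'
    rw [Finset.mem_range] at hn
    rw [Finset.mem_Icc] at hn'
    have h0 : n = 0 := by omega
    subst h0
    simp
  rw [Finset.sum_subset hsub hzero, Complex.re_sum, Complex.re_sum, Finset.mul_sum]
  refine Finset.sum_congr rfl fun n _ ↦ ?_
  rw [weilConv_weilReflect_neg, Complex.add_conj, weilConv_weilReflect_modulate,
    ← Complex.ofReal_div]
  have h1 : ((-t) * Real.log n : ℝ) = -(Real.log n * t) := by ring
  rw [h1, mul_comm (cexp _) (weilConv g (weilReflect g) (Real.log n))]
  simp only [mul_assoc, Complex.re_ofReal_mul, Complex.ofReal_re]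
  ring

/-- Pointwise: `P(g_t ⋆ g̃_t)² ≤ 4 |D(t)|²` with `D` the Dirichlet polynomial of
`re_weilPrimeTerm_modulate`. -/
theorem sq_re_weilPrimeTerm_modulate_le {g : ℝ → ℂ} (hg : IsWeilTest g) {B : ℝ}
    (hB : tsupport g ⊆ Icc (-B) B) {N : ℕ} (hN : 2 * B ≤ Real.log ((N : ℝ) + 1)) (t : ℝ) :
    (weilPrimeTerm (weilConv (fun x ↦ g x * cexp (((-t) * x : ℝ) * I))
        (weilReflect fun x ↦ g x * cexp (((-t) * x : ℝ) * I)))).re ^ 2 ≤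
      4 * ‖∑ n ∈ Finset.Icc 1 N, ((ArithmeticFunction.vonMangoldt n : ℝ) : ℂ) /
          (Real.sqrt n : ℂ) * weilConv g (weilReflect g) (Real.log n) *
          cexp (((-(Real.log n * t) : ℝ) : ℂ) * I)‖ ^ 2 := by
  rw [re_weilPrimeTerm_modulate hg hB hN t, mul_pow]
  have h := abs_le.1 (Complex.abs_re_le_norm
    (∑ n ∈ Finset.Icc 1 N, ((ArithmeticFunction.vonMangoldt n : ℝ) : ℂ) /
      (Real.sqrt n : ℂ) * weilConv g (weilReflect g) (Real.log n) *
      cexp (((-(Real.log n * t) : ℝ) : ℂ) * I)))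
  nlinarith [sq_le_sq' h.1 h.2]

/-- **Window mean square of the prime side**: for `T₁ ≤ T₂`, `supp g ⊆ [-B, B]`,
`2B ≤ log (N+1)`:
`∫_{T₁}^{T₂} P(g_t ⋆ g̃_t)² dt ≤ 4 (T₂ − T₁ + 2N²) · ‖g‖₂⁴ · Σ_{n ≤ N} Λ(n)²/n`. -/
theorem intervalIntegral_sq_re_weilPrimeTerm_modulate_le {g : ℝ → ℂ} (hg : IsWeilTest g)
    {B : ℝ} (hB : tsupport g ⊆ Icc (-B) B) {N : ℕ} (hN : 2 * B ≤ Real.log ((N : ℝ) + 1))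
    {T₁ T₂ : ℝ} (hT : T₁ ≤ T₂) :
    ∫ t in T₁..T₂, (weilPrimeTerm (weilConv (fun x ↦ g x * cexp (((-t) * x : ℝ) * I))
        (weilReflect fun x ↦ g x * cexp (((-t) * x : ℝ) * I)))).re ^ 2 ≤
      4 * (T₂ - T₁ + 2 * (N : ℝ) ^ 2) * ((∫ x : ℝ, ‖g x‖ ^ 2) ^ 2 *
        ∑ n ∈ Finset.Icc 1 N, ArithmeticFunction.vonMangoldt n ^ 2 / (n : ℝ)) := by
  obtain ⟨a, ha⟩ : ∃ a : ℕ → ℂ, a = fun n ↦ ((ArithmeticFunction.vonMangoldt n : ℝ) : ℂ) /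
      (Real.sqrt n : ℂ) * weilConv g (weilReflect g) (Real.log n) := ⟨_, rfl⟩
  obtain ⟨D, hD⟩ : ∃ D : ℝ → ℂ, D = fun t ↦ ∑ n ∈ Finset.Icc 1 N,
      a n * cexp (((-(Real.log n * t) : ℝ) : ℂ) * I) := ⟨_, rfl⟩
  have hP : ∀ t : ℝ, (weilPrimeTerm (weilConv (fun x ↦ g x * cexp (((-t) * x : ℝ) * I))
      (weilReflect fun x ↦ g x * cexp (((-t) * x : ℝ) * I)))).re = 2 * (D t).re := fun t ↦ by
    rw [re_weilPrimeTerm_modulate hg hB hN t, hD, ha]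
  have hDc : Continuous D := by
    rw [hD]
    exact continuous_finsetSum _ fun n _ ↦ continuous_const.mul (Complex.continuous_exp.comp
      ((continuous_ofReal.comp ((continuous_const.mul continuous_id')).neg).mul
        continuous_const))
  -- Step 1: pointwise `P² = (2 Re D)² ≤ 4 |D|²`
  have h1 : ∫ t in T₁..T₂, (weilPrimeTerm (weilConv (fun x ↦ g x * cexp (((-t) * x : ℝ) * I))
      (weilReflect fun x ↦ g x * cexp (((-t) * x : ℝ) * I)))).re ^ 2 ≤
      ∫ t in T₁..T₂, 4 * ‖D t‖ ^ 2 := by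
    have heq : (fun t : ℝ ↦ (weilPrimeTerm (weilConv (fun x ↦ g x * cexp (((-t) * x : ℝ) * I))
        (weilReflect fun x ↦ g x * cexp (((-t) * x : ℝ) * I)))).re ^ 2) =
        fun t ↦ (2 * (D t).re) ^ 2 := funext fun t ↦ by rw [hP]
    rw [heq]
    refine intervalIntegral.integral_mono_on hT
      (((continuous_const.mul (Complex.continuous_re.comp hDc)).pow 2).intervalIntegrable _ _)
      ((continuous_const.mul ((continuous_norm.comp hDc).pow 2)).intervalIntegrable _ _)
      fun t _ ↦ ?_
    have h := abs_le.1 (Complex.abs_re_le_norm (D t))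
    nlinarith [sq_le_sq' h.1 h.2]
  -- Step 2: the crude Hilbert inequality (T72a)
  have h2 : ∫ t in T₁..T₂, 4 * ‖D t‖ ^ 2 = 4 * ∫ t in T₁..T₂, ‖D t‖ ^ 2 :=
    intervalIntegral.integral_const_mul _ _
  have h3 : ∫ t in T₁..T₂, ‖D t‖ ^ 2 ≤
      (T₂ - T₁ + 2 * (N : ℝ) ^ 2) * ∑ n ∈ Finset.Icc 1 N, ‖a n‖ ^ 2 := by
    rw [hD]
    exact norm_sq_dirichletSum_intervalIntegral_le N a T₁ T₂
  -- Step 3: the coefficients, `|φ(log n)| ≤ ‖g‖₂²`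
  have h4 : ∑ n ∈ Finset.Icc 1 N, ‖a n‖ ^ 2 ≤ (∫ x : ℝ, ‖g x‖ ^ 2) ^ 2 *
      ∑ n ∈ Finset.Icc 1 N, ArithmeticFunction.vonMangoldt n ^ 2 / (n : ℝ) := by
    rw [Finset.mul_sum]
    refine Finset.sum_le_sum fun n hn ↦ ?_
    rw [Finset.mem_Icc] at hn
    have hn0 : (0 : ℝ) < n := by exact_mod_cast hn.1
    have hnorm : ‖a n‖ = ArithmeticFunction.vonMangoldt n / Real.sqrt n *
        ‖weilConv g (weilReflect g) (Real.log n)‖ := by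
      simp only [ha, norm_mul, norm_div, Complex.norm_real,
        Real.norm_of_nonneg ArithmeticFunction.vonMangoldt_nonneg,
        Real.norm_of_nonneg (Real.sqrt_nonneg _)]
    have hφ : ‖weilConv g (weilReflect g) (Real.log n)‖ ^ 2 ≤ (∫ x : ℝ, ‖g x‖ ^ 2) ^ 2 :=
      pow_le_pow_left₀ (norm_nonneg _) (norm_weilConv_weilReflect_le hg _) 2
    have hc0 : 0 ≤ ArithmeticFunction.vonMangoldt n ^ 2 / (n : ℝ) := by
      have := ArithmeticFunction.vonMangoldt_nonneg (n := n)
      positivity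
    rw [hnorm, mul_pow, div_pow, Real.sq_sqrt hn0.le]
    calc ArithmeticFunction.vonMangoldt n ^ 2 / (n : ℝ) *
          ‖weilConv g (weilReflect g) (Real.log n)‖ ^ 2
        ≤ ArithmeticFunction.vonMangoldt n ^ 2 / (n : ℝ) * (∫ x : ℝ, ‖g x‖ ^ 2) ^ 2 :=
          mul_le_mul_of_nonneg_left hφ hc0
      _ = (∫ x : ℝ, ‖g x‖ ^ 2) ^ 2 * (ArithmeticFunction.vonMangoldt n ^ 2 / (n : ℝ)) := by
          ring
  have hT' : 0 ≤ T₂ - T₁ + 2 * (N : ℝ) ^ 2 := by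
    have := sub_nonneg.2 hT
    positivity
  calc ∫ t in T₁..T₂, (weilPrimeTerm (weilConv (fun x ↦ g x * cexp (((-t) * x : ℝ) * I))
        (weilReflect fun x ↦ g x * cexp (((-t) * x : ℝ) * I)))).re ^ 2
      ≤ ∫ t in T₁..T₂, 4 * ‖D t‖ ^ 2 := h1
    _ = 4 * ∫ t in T₁..T₂, ‖D t‖ ^ 2 := h2
    _ ≤ 4 * ((T₂ - T₁ + 2 * (N : ℝ) ^ 2) * ∑ n ∈ Finset.Icc 1 N, ‖a n‖ ^ 2) :=
        mul_le_mul_of_nonneg_left h3 (by norm_num)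
    _ ≤ 4 * ((T₂ - T₁ + 2 * (N : ℝ) ^ 2) * ((∫ x : ℝ, ‖g x‖ ^ 2) ^ 2 *
          ∑ n ∈ Finset.Icc 1 N, ArithmeticFunction.vonMangoldt n ^ 2 / (n : ℝ))) :=
        mul_le_mul_of_nonneg_left (mul_le_mul_of_nonneg_left h4 hT') (by norm_num)
    _ = _ := by ring

end Summit.RiemannHypothesis.RiemannHypothesis.Theorems

end
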